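import Literature.AlgebraicGeometry.Resolution.SmoothStalkOrderCriterion
import Literature.AlgebraicGeometry.Resolution.DiffIdealStalk
import Literature.AlgebraicGeometry.Resolution.OrderSemicontinuity
import Literature.AlgebraicGeometry.Resolution.QuasiExcellentSchemes
import Literature.AlgebraicGeometry.Resolution.ExcellentRingsFieldProofs
import Literature.AlgebraicGeometry.Resolution.AlterationsLemma32
import Mathlib.AlgebraicGeometry.Morphisms.FiniteType
import HarnessLib

/-!
# The cosupport of `Diff^{≤ n}(𝓘)` is the locus `{ord 𝓘 ≥ n + 1}` (smooth schemes over a perfect field)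

Topic: `Literature/AlgebraicGeometry/Resolution`. The classical description of the order stratification of a
quasi-coherent ideal sheaf `𝓘` on a scheme `X` smooth over a PERFECT field `K` by differential operators
([VillamayorU2008ReesDiff] §4.1 «Diff^{b−1}_k(I) proper iff order ≥ b»; [EGAIV4] §16.8): the closed set
`Supp(𝒪_X / Diff^{≤ n}(𝓘))` (Mathlib `Scheme.IdealSheafData.support` of the tree's `diffIdealSheaf`) is the set of points
`x` with `ord_x 𝓘 ≥ n + 1` (`Resolution.idealOrder`), at ALL points of `X`, closed or not.

* `stalkIdeal_diffIdealSheaf_eq_top_of_not_le_idealOrder`, `mem_support_diffIdealSheaf_iff_of_isClosed` — at a CLOSED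
  point `x`: `x ∈ Supp(Diff^{≤ n} 𝓘) ↔ n + 1 ≤ ord_x 𝓘` (the stalk criterion of `SmoothStalkOrderCriterion.lean` — étale
  coordinates and Hasse–Schmidt operators, `K` perfect — moved to the sheaf via `stalkIdeal_diffIdealSheaf`);
* `mem_support_diffIdealSheaf_of_le_idealOrder` — the elementary direction at every point and for every `K`-structure
  with finite-type sections: `n + 1 ≤ ord_x 𝓘 ⇒ x ∈ Supp(Diff^{≤ n} 𝓘)` (operators of order `≤ n` map `𝔪^{n+1}` into `𝔪`);
* `support_diffIdealSheaf_eq_setOf_le_idealOrder` — for `X` integral and Noetherian, `f : X → Spec K` smooth, `K`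
  perfect: `Supp(Diff^{≤ n} 𝓘) = {x | n + 1 ≤ ord_x 𝓘}` as sets. The passage from closed points to all points uses that
  `X` is a Jacobson space (finite type over a field), that the support is closed, and the upper semicontinuity of the
  order (`isClosed_setOf_le_idealOrder`: `X` regular — smooth over a field — and excellent — `Stacks07QW_field_holds`).

Consumer (index only): the Hironaka-2017 adjudication cell `res-hironaka` reads «`Sing(E) = V(Diff^{(b−1)} J)`» for
`E = (J, b)` through this file (`Hironaka2017/Lib/PAlgOffSing.lean`); nothing about that manuscript is asserted here.
Sources: [VillamayorU2008ReesDiff] §4.1, Remark 4.3; [EGAIV4] §16.8, Thm. 16.11.2; [CossartPiltant2008] Prop. 4.2 (proof: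
upper semicontinuity of the order).
-/

noncomputable section

namespace Literature.AlgebraicGeometry.Resolution

open CategoryTheory _root_.AlgebraicGeometry TopologicalSpace IsLocalRing Opposite

universe u v

/-! ## The elementary direction, every point, every `K`-structure with finite-type sections -/

section Elementary

variable {K : Type v} [Field K] {X : Scheme.{u}} {φ : K →+* Γ(X, ⊤)}

/-- **`ord_x 𝓘 ≥ n + 1 ⇒ x ∈ Supp(𝒪_X / Diff^{≤ n}(𝓘))`** at every point `x`, for a `K`-structure `φ` with finite-type
sections: `(Diff^{≤ n} 𝓘)_x = Diff^{≤ n}(𝓘_x)` (`stalkIdeal_diffIdealSheaf`) and operators of order `≤ n` map `𝔪_x^{n+1}`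
into `𝔪_x` (`diffIdeal_le_of_le_pow_succ`). [cite: VillamayorU2008ReesDiff, §4.1 (Diff^{b−1}(I) ⊆ 𝔪 when ord ≥ b)] -/
theorem mem_support_diffIdealSheaf_of_le_idealOrder (hX : HasFiniteTypeSections φ) (I : X.IdealSheafData) {x : X}
    {n : ℕ} (h : ((n + 1 : ℕ) : ℕ∞) ≤ idealOrder I x) : x ∈ (diffIdealSheaf φ n I).support := by
  rw [mem_support_iff_stalkIdeal_le, stalkIdeal_diffIdealSheaf hX n I x]
  letI := stalkAlgebra φ x
  rw [le_idealOrder_iff] at h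
  exact diffIdeal_le_of_le_pow_succ K h

/-- The stalks of the zero ideal sheaf vanish. [folklore] -/
private theorem stalkIdeal_bot'' (x : X) : stalkIdeal (⊥ : X.IdealSheafData) x = ⊥ := by
  obtain ⟨U, hU, hxU, -⟩ := exists_isAffineOpen_mem_and_subset (X := X) (x := x) (U := ⊤)
    (Opens.mem_top _)
  rw [stalkIdeal_eq_map_germ ⊥ ⟨U, hU⟩ hxU, Scheme.IdealSheafData.ideal_bot, Pi.bot_apply,
    Ideal.map_bot]

/-- `ord_x(0) = ⊤` at every point. [folklore] -/
private theorem idealOrder_bot_eq_top' (x : X) : idealOrder (⊥ : X.IdealSheafData) x = ⊤ := by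
  refine eq_top_iff.mpr (ENat.forall_natCast_le_iff_le.mp fun c _ => ?_)
  rw [le_idealOrder_iff, stalkIdeal_bot'']
  exact bot_le

end Elementary

/-! ## Closed points of a scheme smooth over a perfect field -/

section Smooth

variable {K : Type u} [Field K] {X : Scheme.{u}} (f : X ⟶ Spec (.of K))

/-- **`(Diff^{≤ n} 𝓘)_x = 𝒪_{X,x}` at a CLOSED point `x` with `ord_x 𝓘 ≤ n`** (`f : X → Spec K` smooth, `K` perfect; the
`K`-structure `f.appTop ∘ (ΓSpecIso K)⁻¹`): the stalk criterion `diffIdeal_stalk_eq_top_iff_not_le_pow_of_smooth` moved to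
the ideal sheaf `Diff^{≤ n}(𝓘)` by `stalkIdeal_diffIdealSheaf`. [cite: VillamayorU2008ReesDiff, §4.1 and Remark 4.3] -/
theorem stalkIdeal_diffIdealSheaf_eq_top_of_not_le_idealOrder [Smooth f] [PerfectField K] (I : X.IdealSheafData)
    {x : X} (hx : IsClosed ({x} : Set X)) {n : ℕ} (hord : ¬ ((n + 1 : ℕ) : ℕ∞) ≤ idealOrder I x) :
    stalkIdeal (diffIdealSheaf (f.appTop.hom.comp (Scheme.ΓSpecIso (.of K)).inv.hom) n I) x = ⊤ := by
  rw [stalkIdeal_diffIdealSheaf (hasFiniteTypeSections_of_locallyOfFiniteType K f) n I x]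
  rw [le_idealOrder_iff] at hord
  exact (diffIdeal_stalk_eq_top_iff_not_le_pow_of_smooth f x hx n (stalkIdeal I x)).mpr hord

/-- **At a CLOSED point: `x ∈ Supp(𝒪_X / Diff^{≤ n} 𝓘) ↔ n + 1 ≤ ord_x 𝓘`** (`f : X → Spec K` smooth, `K` perfect).
[cite: VillamayorU2008ReesDiff, §4.1 and Remark 4.3 (Diff^{b−1}(I)_x proper iff ord_x I ≥ b, closed points)] -/
theorem mem_support_diffIdealSheaf_iff_of_isClosed [Smooth f] [PerfectField K] (I : X.IdealSheafData) {x : X}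
    (hx : IsClosed ({x} : Set X)) (n : ℕ) :
    x ∈ (diffIdealSheaf (f.appTop.hom.comp (Scheme.ΓSpecIso (.of K)).inv.hom) n I).support ↔
      ((n + 1 : ℕ) : ℕ∞) ≤ idealOrder I x := by
  refine ⟨fun hmem => ?_,
    mem_support_diffIdealSheaf_of_le_idealOrder (hasFiniteTypeSections_of_locallyOfFiniteType K f) I⟩
  by_contra hord
  have htop := stalkIdeal_diffIdealSheaf_eq_top_of_not_le_idealOrder f I hx hord
  rw [mem_support_iff_stalkIdeal_le, htop, top_le_iff] at hmem
  exact (maximalIdeal.isMaximal (X.presheaf.stalk x)).ne_top hmem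

/-- **`Supp(𝒪_X / Diff^{≤ n}(𝓘)) = {x | n + 1 ≤ ord_x 𝓘}` at ALL points**, for `X` integral and Noetherian, `f : X → Spec K`
smooth, `K` perfect, and every quasi-coherent ideal sheaf `𝓘`. «⊇» is `mem_support_diffIdealSheaf_of_le_idealOrder`;
for «⊆», the support is closed and `X` is a Jacobson space (`LocallyOfFiniteType.jacobsonSpace`), so the support is
the closure of its closed points, which lie in the order locus by `mem_support_diffIdealSheaf_iff_of_isClosed`; the order
locus is closed (upper semicontinuity `isClosed_setOf_le_idealOrder` on the regular — `Scheme.IsRegular.of_smooth` —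
and excellent — `Scheme.isExcellent_of_locallyOfFiniteType Stacks07QW_field_holds` — integral Noetherian `X`; for
`𝓘 = 0` both sides are all of `X`). [cite: VillamayorU2008ReesDiff, §4.1 and Remark 4.3] [cite: CossartPiltant2008,
Prop. 4.2 (proof: upper semicontinuity of the order)] -/
theorem support_diffIdealSheaf_eq_setOf_le_idealOrder [IsIntegral X] [IsNoetherian X] [Smooth f] [PerfectField K]
    (I : X.IdealSheafData) (n : ℕ) :
    ((diffIdealSheaf (f.appTop.hom.comp (Scheme.ΓSpecIso (.of K)).inv.hom) n I).support : Set X) =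
      {x : X | ((n + 1 : ℕ) : ℕ∞) ≤ idealOrder I x} := by
  have hft := hasFiniteTypeSections_of_locallyOfFiniteType K f
  refine Set.Subset.antisymm ?_ fun x hx => mem_support_diffIdealSheaf_of_le_idealOrder hft I hx
  -- the order locus is closed
  have hS : IsClosed {x : X | ((n + 1 : ℕ) : ℕ∞) ≤ idealOrder I x} := by
    by_cases hI : I = ⊥
    · subst hI
      have : {x : X | ((n + 1 : ℕ) : ℕ∞) ≤ idealOrder (⊥ : X.IdealSheafData) x} = Set.univ :=
        Set.eq_univ_of_forall fun x => by
          rw [Set.mem_setOf_eq, idealOrder_bot_eq_top' x]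
          exact le_top
      rw [this]
      exact isClosed_univ
    · have hR : Scheme.IsRegular X := Scheme.IsRegular.of_smooth f (Scheme.isRegular_Spec (CommRingCat.of K))
      have hE : Scheme.IsExcellent X := Scheme.isExcellent_of_locallyOfFiniteType Stacks07QW_field_holds f
      exact isClosed_setOf_le_idealOrder hR hE hI _
  -- closed points of the support lie in the order locus; `X` is Jacobson
  haveI : JacobsonSpace X := LocallyOfFiniteType.jacobsonSpace f
  have hcl : ((diffIdealSheaf (f.appTop.hom.comp (Scheme.ΓSpecIso (.of K)).inv.hom) n I).support : Set X) ∩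
      closedPoints X ⊆ {x : X | ((n + 1 : ℕ) : ℕ∞) ≤ idealOrder I x} := by
    rintro x ⟨hxT, hxc⟩
    rw [mem_closedPoints_iff] at hxc
    exact (mem_support_diffIdealSheaf_iff_of_isClosed f I hxc n).mp hxT
  calc ((diffIdealSheaf (f.appTop.hom.comp (Scheme.ΓSpecIso (.of K)).inv.hom) n I).support : Set X)
      = closure (((diffIdealSheaf (f.appTop.hom.comp (Scheme.ΓSpecIso (.of K)).inv.hom) n I).support : Set X) ∩
          closedPoints X) := (closure_inter_closedPoints (Scheme.IdealSheafData.support _).isClosed).symm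
    _ ⊆ {x : X | ((n + 1 : ℕ) : ℕ∞) ≤ idealOrder I x} := closure_minimal hcl hS

end Smooth

end Literature.AlgebraicGeometry.Resolution

end
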